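import Mathlib
import HarnessLib
import Literature.Analysis.FluidPDE.ClassicalSolution
import Literature.Analysis.FluidPDE.VectorCalculus
import Summits.NavierStokesRegularity.NavierStokesRegularity.Theses.UnthreadedRigidityDoor
import Summits.NavierStokesRegularity.NavierStokesRegularity.Theorems.UnthreadedRigidityDoorUnthreadedRigidityProfileHornShellZero
import Summits.NavierStokesRegularity.NavierStokesRegularity.Theorems.UnthreadedRigidityDoorUnthreadedRigidityVirialHornCompositions
import Summits.NavierStokesRegularity.NavierStokesRegularity.Theorems.UnthreadedRigidityDoorUnthreadedRigidityMixedPairDefs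

/-!
# Route `UnthreadedRigidityDoor`, item `UnthreadedRigidity` (W2, stmt-NavierStokesRegularity-27585) — LINE g11-2 «MIXED PAIR»:
# the kernel-checked COMPOSITIONS BY NAME (Theorems-side twin of the sketch's theorems, core sector)

Prover file (engine-1 g71, DIRECTOR-NS dss_147 (3); `--supports stmt-NavierStokesRegularity-27585 --as helper`) for LINE g11-2 «MIXED PAIR» of
planner ns-idea-6 g11/g12 (sketch `MixedPair_sketch.lean` v1.4 fdd225c37c2e9dbd; objects BY NAME in `…MixedPairDefs.lean`).  VERBATIM from the
sketch: `firstJet_vanishes_of_linked` (modulo O1 a LINKED pair is silent at order one — the counterexample survives one order more than any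
separable/isotypic datum), the bookkeeping lemmas `pairShell_of_null_left/right`, `coaxial_or_not`, `isOblique_of_transverse`, and the three
compositions `mixedPairOrderTwoRigidity_of_bridges` (O1 ∧ S-L ∧ S-X ∧ O2a ∧ O2b ∧ S-H ∧ S-D ∧ S-Q ⇒ slice rung), `mixedPairWindowRigidity_of_crux`
(the window rung is a restriction of the crux), `mixedPairWindowRigidity_of_bridges` (O-W ∧ S-HW ∧ S-QW ∧ S-X ∧ S-D ∧ S-U ⇒ window rung);
`sepShellL_null`, `isSliceAxisymmetric_of_eq_zero`, `curl_zero_field` are the landed VIRIAL/PROFILE HORN ones (not re-declared).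

HONEST LABEL: plumbing of a RUNG line about SPECIAL two-shell data; `UnthreadedRigidity` (27585), W2 and NS regularity remain OPEN; nothing here is a
statement about the Navier–Stokes equations; nobody here claims `UnthreadedRigidity`.  0 kit.
-/

-- the summit and its single sub-problem share the name (CONVENTIONS §1), as in every Theorems file
set_option linter.dupNamespace false

namespace Summit.NavierStokesRegularity.NavierStokesRegularity.Theorems.UnthreadedRigidity.MixedPair

open scoped Topology
open Filter Set
open Summit.NavierStokesRegularity.NavierStokesRegularity.Theorems.UnthreadedRigidity.ProfileHorn (E3 threadingFlux IsSliceAxisymmetric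
  isSliceAxisymmetric_of_eq_zero curl_zero_field)
open Summit.NavierStokesRegularity.NavierStokesRegularity.Theorems.UnthreadedRigidity.VirialHorn (e det3 vortAmpL VirialAdmissible sepShellL
  WindowAxisUniform sepShellL_null)

/-! ### The counterexample survives order one -/

/-- KERNEL: modulo bridge O1, a LINKED pair is silent at order one — the built counterexample survives one order more than any separable or
isotypic datum (for those, order-one silence already forces a single shell: WEDGE, g9/g11-1). -/
theorem firstJet_vanishes_of_linked (hO1 : OrderOneLawPair)
    (t₀ T : ℝ) (u : ℝ → E3 → E3) (p : ℝ → E3 → ℝ) (x₀ a : E3) (Q : E3 →L[ℝ] E3) (H₁ H₂ : ℝ → ℝ)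
    (hT : t₀ < T) (hsol : Literature.Analysis.FluidPDE.IsClassicalNSSolutionOn (Set.Ico t₀ T) 1 0 u p)
    (hp : ∀ t ∈ Set.Ico t₀ T, Tendsto (p t) (cocompact E3) (𝓝 0))
    (hcd : ∀ x : E3, ContDiffWithinAt ℝ 2 (fun t => threadingFlux u x₀ t x) (Set.Ici t₀) t₀)
    (hadm : PairAdmissible H₁ H₂ a Q) (hu : u t₀ = pairShell H₁ H₂ a Q x₀) (hlink : IsLinked H₁ H₂) :
    ∀ x : E3, iteratedDerivWithin 1 (fun t => threadingFlux u x₀ t x) (Set.Ici t₀) t₀ = 0 := by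
  intro x
  rw [hO1 t₀ T u p x₀ a Q H₁ H₂ hT hsol hp hcd hadm hu x]
  by_cases hx : x = x₀
  · subst hx
    simp [det3]
  · have hr : 0 < ‖x - x₀‖ := norm_pos_iff.mpr (sub_ne_zero.mpr hx)
    have h0 : H₁ ‖x - x₀‖ * vortAmpL 2 H₂ ‖x - x₀‖ - 3 * (H₂ ‖x - x₀‖ * vortAmpL 1 H₁ ‖x - x₀‖) = 0 :=
      sub_eq_zero.mpr (hlink ‖x - x₀‖ hr)
    rw [h0]
    ring

/-! ### small proved lemmas -/

/-- a pair with null dipole profile is the quadrupole shell. -/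
lemma pairShell_of_null_left (H₁ H₂ : ℝ → ℝ) (a : E3) (Q : E3 →L[ℝ] E3) (x₀ : E3) (h : IsNullProfile H₁) :
    pairShell H₁ H₂ a Q x₀ = sepShellL H₂ (quadHarmonic Q) x₀ := by
  funext x
  show sepShellL H₁ (dipoleHarmonic a) x₀ x + sepShellL H₂ (quadHarmonic Q) x₀ x = sepShellL H₂ (quadHarmonic Q) x₀ x
  rw [sepShellL_null H₁ (dipoleHarmonic a) x₀ h x, zero_add]

/-- a pair with null quadrupole profile is the dipole shell. -/
lemma pairShell_of_null_right (H₁ H₂ : ℝ → ℝ) (a : E3) (Q : E3 →L[ℝ] E3) (x₀ : E3) (h : IsNullProfile H₂) :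
    pairShell H₁ H₂ a Q x₀ = sepShellL H₁ (dipoleHarmonic a) x₀ := by
  funext x
  show sepShellL H₁ (dipoleHarmonic a) x₀ x + sepShellL H₂ (quadHarmonic Q) x₀ x = sepShellL H₁ (dipoleHarmonic a) x₀ x
  rw [sepShellL_null H₂ (quadHarmonic Q) x₀ h x, add_zero]

/-- excluded middle on coaxiality (bookkeeping). -/
lemma coaxial_or_not (a : E3) (Q : E3 →L[ℝ] E3) : IsCoaxial a Q ∨ ¬ IsCoaxial a Q := em _

/-- a transverse shape with a weight-1 part is oblique (bookkeeping). -/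
lemma isOblique_of_transverse {a : E3} {Q : E3 →L[ℝ] E3} (h : IsTransverse a Q) (hq : Q a ≠ 0) : IsOblique a Q :=
  ⟨h.1, hq, h.2 hq⟩

/-! ### Compositions (kernel-checked) -/

/-- COMPOSITION S (slice): O1 ∧ S-L ∧ S-X ∧ O2a ∧ O2b ∧ S-H ∧ S-D ∧ S-Q ⇒ the mixed-pair slice rung. -/
theorem mixedPairOrderTwoRigidity_of_bridges (hO1 : OrderOneLawPair) (hSL : OrderOneSilenceLinks) (hX : CoaxialPairAxisym)
    (hOb : ObliqueVirialRigidity) (hEq : EquatorialDichotomy) (hH : HelmholtzPairDead) (hD : DipoleShellAxisym)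
    (hQ : QuadShellOrderTwoRigidity) : MixedPairOrderTwoRigidity := by
  intro t₀ T u p x₀ a Q H₁ H₂ hT hsol hp hcd hadm hcls hu hA1 hA2 hj1 hj2
  rcases coaxial_or_not a Q with hco | hnco
  · rw [hu]; exact hX H₁ H₂ a Q x₀ hadm hco
  · have htr : IsTransverse a Q := hcls.resolve_left hnco
    -- how to finish from a null profile
    have null1 : IsNullProfile H₁ → IsSliceAxisymmetric (u t₀) x₀ := by
      intro h1
      have hu' : u t₀ = sepShellL H₂ (quadHarmonic Q) x₀ := by rw [hu]; exact pairShell_of_null_left H₁ H₂ a Q x₀ h1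
      exact hQ t₀ T u p x₀ Q H₂ hT hsol hp hcd hadm.2.1 hadm.2.2.2 hu' hj2
    have null2 : IsNullProfile H₂ → IsSliceAxisymmetric (u t₀) x₀ := by
      intro h2
      rw [hu, pairShell_of_null_right H₁ H₂ a Q x₀ h2]
      exact hD H₁ a x₀ hadm.1 hadm.2.2.1
    by_cases hq : Q a = 0
    · -- EQUATORIAL: order one links the profiles, order two gives the dichotomy, the Helmholtz branch is dead
      have hlink : IsLinked H₁ H₂ := by
        apply hSL H₁ H₂ a Q hadm hnco
        intro y
        have key := hO1 t₀ T u p x₀ a Q H₁ H₂ hT hsol hp hcd hadm hu (y + x₀)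
        rw [hj1 (y + x₀)] at key
        simp only [add_sub_cancel_right] at key
        have : -4 * ((H₁ ‖y‖ * vortAmpL 2 H₂ ‖y‖ - 3 * (H₂ ‖y‖ * vortAmpL 1 H₁ ‖y‖)) * det3 y a (Q y)) = 0 := key.symm
        linarith [this]
      rcases hEq t₀ T u p x₀ a Q H₁ H₂ hT hsol hp hcd hadm hq hnco hu hA1 hA2 hlink hj2 with h1 | h2 | hhelm
      · exact null1 h1
      · exact null2 h2
      · rcases hH t₀ T u p x₀ a Q H₁ H₂ hT hsol hp hcd hadm hnco hu hhelm hj2 with h1 | h2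
        · exact null1 h1
        · exact null2 h2
    · -- OBLIQUE: the isolated virial functional kills the quadrupole (second jet only)
      exact null2 (hOb t₀ T u p x₀ a Q H₁ H₂ hT hsol hp hcd hadm (isOblique_of_transverse htr hq) hu hA2 hj2)

/-- COMPOSITION R (bookkeeping): the window rung is a restriction of the crux — a genuine rung BELOW 27585. -/
theorem mixedPairWindowRigidity_of_crux
    (h : Summit.NavierStokesRegularity.NavierStokesRegularity.Theses.UnthreadedRigidityDoor.UnthreadedRigidity) :
    MixedPairWindowRigidity := by
  intro S hS hconn u x₀ hcont hdiv hmild hbdd hunth hpair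
  exact h S hS hconn u x₀ hcont hdiv hmild hbdd hunth

/-- COMPOSITION W (kernel-checked): the WINDOW rung follows from the window bridge O-W, the supports S-HW, S-QW, S-X, S-D and S-U. -/
theorem mixedPairWindowRigidity_of_bridges (hR : PairWindowReduction) (hHW : HelmholtzWindowDead) (hQW : QuadShellWindowAxisym)
    (hX : CoaxialPairAxisym) (hD : DipoleShellAxisym) (hU : WindowAxisUniform) : MixedPairWindowRigidity := by
  intro S hS hconn u x₀ hcont hdiv hmild hbdd hunth hpair
  obtain ⟨a, Q, H₁f, H₂f, hcls, hslice⟩ := hpair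
  have hax : ∀ t ∈ S, IsSliceAxisymmetric (u t) x₀ := by
    intro t ht
    rcases coaxial_or_not a Q with hco | hnco
    · rw [(hslice t ht).2]; exact hX (H₁f t) (H₂f t) a Q x₀ (hslice t ht).1 hco
    · have htr : IsTransverse a Q := hcls.resolve_left hnco
      have null1 : IsNullProfile (H₁f t) → IsSliceAxisymmetric (u t) x₀ := by
        intro h1
        have hu' : u t = sepShellL (H₂f t) (quadHarmonic Q) x₀ := by
          rw [(hslice t ht).2]; exact pairShell_of_null_left (H₁f t) (H₂f t) a Q x₀ h1
        exact hQW S hS u x₀ hcont hdiv hmild hbdd hunth t ht Q (H₂f t) (hslice t ht).1.2.1 (hslice t ht).1.2.2.2 hu'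
      have null2 : IsNullProfile (H₂f t) → IsSliceAxisymmetric (u t) x₀ := by
        intro h2
        rw [(hslice t ht).2, pairShell_of_null_right (H₁f t) (H₂f t) a Q x₀ h2]
        exact hD (H₁f t) a x₀ (hslice t ht).1.1 (hslice t ht).1.2.2.1
      rcases hR S hS u x₀ hcont hdiv hmild hbdd hunth a Q H₁f H₂f htr hnco hslice t ht with h1 | h2 | hhelm
      · exact null1 h1
      · exact null2 h2
      · rcases hHW S hS u x₀ hcont hdiv hmild hbdd hunth a Q H₁f H₂f hnco hslice t ht hhelm with h1 | h2
        · exact null1 h1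
        · exact null2 h2
  exact hU S hS hconn u x₀ hcont hdiv hmild hbdd hax

end Summit.NavierStokesRegularity.NavierStokesRegularity.Theorems.UnthreadedRigidity.MixedPair
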